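import Mathlib
import HarnessLib
import Summits.NavierStokesRegularity.NavierStokesRegularity.Theorems.PlaneStrainDoorTypeFreeRung

/-!
# nsreg-p1 ROUND-15 rung L0 `TypeFreeMidStrainRung (1/8)` — the TEXT of r15/Sketch16.lean, proved

p1 g13's `r15/Sketch16.lean` types the global type-free rung as
`TypeFreeMidStrainRung ε₀ := ∀ ν T, … classical on [0,T) → Leray–Hopf → rapid decay → ∀ ε, 0 ≤ ε → ε < ε₀ →
∀ a ∈ [0,T), (∀ t ∈ [a,T), ∀ x, MidStrainMajorant (∇u(t,x)) (ε/(T−t))) → HasSmoothExtensionPast ν 0 u T`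
with `MidStrainMajorant A m := ∃ v w, ‖v‖ = 1 ∧ ‖w‖ = 1 ∧ ⟪v,w⟫ = 0 ∧ ∀ α β, ⟪A(αv+βw), αv+βw⟫ ≤ m(α²+β²)`.
`typeFreeMidStrainRung_one_eighth` is that statement for `ε₀ = 1/8` with `MidStrainMajorant` unfolded (the sketch's
definition is not in the tree yet): restart the Leray–Hopf evolution at a good time `s₁ ∈ (a,T)`
(`IsLerayHopfOn.exists_isLerayHopfOn_restart_Ioo`), apply `hasSmoothExtensionPast_of_middleEigenvalue_le_typeI`
(p498836) to `t ↦ u(t + s₁)` on `[0, T − s₁)`, and glue the extension back (`IsClassicalNSSolutionOn.glue`).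
The rapid-decay hypothesis is not used.  Seat nsreg-p6 g7 (`--supports stmt-NavierStokesRegularity-11719`).
WHAT THIS IS NOT: not NS regularity — an explicit-constant conditional continuation criterion; not a route open.
-/

noncomputable section

open MeasureTheory Set Function Filter Topology InnerProductSpace
open scoped ENNReal NNReal RealInnerProductSpace
open Literature.Analysis Literature.Analysis.FluidPDE

-- the summit and its single sub-problem share the name (CONVENTIONS §1), as in every Theorems file
set_option linter.dupNamespace false

namespace Summit.NavierStokesRegularity.NavierStokesRegularity.Theorems.PlaneStrainDoorTypeFreeRungText

open Summit.NavierStokesRegularity.NavierStokesRegularity.Theorems.PlaneStrainDoorTypeFreeRung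

/-- **rung L0 `TypeFreeMidStrainRung (1/8)`** (text of nsreg-p1 `r15/Sketch16.lean`, `MidStrainMajorant` unfolded):
a classical Leray–Hopf solution from rapidly decaying data with `λ₂(∇u(t,x)) ≤ ε/(T−t)` on `[a,T) × ℝ³` for some
`a ∈ [0,T)` and `0 ≤ ε < 1/8` extends smoothly past `T`. -/
theorem typeFreeMidStrainRung_one_eighth :
    ∀ (ν T : ℝ), 0 < ν → 0 < T → ∀ (u : ℝ → EuclideanSpace ℝ (Fin 3) → EuclideanSpace ℝ (Fin 3))
      (p : ℝ → EuclideanSpace ℝ (Fin 3) → ℝ),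
    IsClassicalNSSolutionOn (Set.Ico 0 T) ν 0 u p →
    IsLerayHopfOn T ν 0 (u 0) u →
    HasRapidSpatialDecay (u 0) →
    ∀ ε : ℝ, 0 ≤ ε → ε < 1 / 8 → ∀ a ∈ Set.Ico 0 T,
    (∀ t ∈ Set.Ico a T, ∀ x, ∃ v w : EuclideanSpace ℝ (Fin 3), ‖v‖ = 1 ∧ ‖w‖ = 1 ∧ inner ℝ v w = 0 ∧
      ∀ α β : ℝ, inner ℝ (fderiv ℝ (u t) x (α • v + β • w)) (α • v + β • w) ≤ ε / (T - t) * (α ^ 2 + β ^ 2)) →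
    HasSmoothExtensionPast ν 0 u T := by
  intro ν T hν hT u p hcl hLH _ ε hε0 hε a ha hmaj
  -- a good restart time `s₁ ∈ (a, T)`
  obtain ⟨s₁, hs₁, hLHs⟩ := hLH.exists_isLerayHopfOn_restart_Ioo hν.le ha.1 ha.2 le_rfl
  have hs₁0 : 0 ≤ s₁ := ha.1.trans hs₁.1.le
  have hTs : 0 < T - s₁ := sub_pos.2 hs₁.2
  -- the shifted solution `U t = u (t + s₁)` on `[0, T - s₁)`
  set U : ℝ → EuclideanSpace ℝ (Fin 3) → EuclideanSpace ℝ (Fin 3) := fun t => u (t + s₁) with hU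
  have hclU : IsClassicalNSSolutionOn (Ico 0 (T - s₁)) ν 0 U (fun t => p (t + s₁)) := by
    have h := hcl.comp_add_right s₁
    have h0 : (fun t => (0 : ℝ → EuclideanSpace ℝ (Fin 3) → EuclideanSpace ℝ (Fin 3)) (t + s₁)) = 0 := rfl
    rw [h0] at h
    exact h.mono (fun t ht => by
      simp only [mem_Ico] at ht ⊢; constructor <;> linarith [ht.1, ht.2]) (uniqueDiffOn_Ico 0 _)
  have hLHU : IsLerayHopfOn (T - s₁) ν 0 (U 0) U := by
    have : U 0 = u s₁ := by simp [hU]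
    rw [this]; exact hLHs
  have hmajU : ∀ t ∈ Ico 0 (T - s₁), ∀ x, ∃ v w : EuclideanSpace ℝ (Fin 3), ‖v‖ = 1 ∧ ‖w‖ = 1 ∧
      ⟪v, w⟫ = 0 ∧ ∀ α β : ℝ,
        ⟪fderiv ℝ (U t) x (α • v + β • w), α • v + β • w⟫ ≤ ε / (T - s₁ - t) * (α ^ 2 + β ^ 2) := by
    intro t ht x
    have ht' : t + s₁ ∈ Ico a T := ⟨by linarith [ht.1, hs₁.1], by linarith [ht.2]⟩
    have e1 : T - s₁ - t = T - (t + s₁) := by ring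
    rw [e1]
    exact hmaj (t + s₁) ht' x
  -- extension of the shifted solution past `T - s₁`
  obtain ⟨T'', hT'', U', P', hU', hagree⟩ :=
    hasSmoothExtensionPast_of_middleEigenvalue_le_typeI hν hTs hε0 hε hclU hLHU hmajU
  -- shift back and glue along `(s₁, T)`
  have h₂ : IsClassicalNSSolutionOn (Ioo s₁ (s₁ + T'')) ν 0 (fun t => U' (t + -s₁)) (fun t => P' (t + -s₁)) := by
    have h := hU'.comp_add_right (-s₁)
    have h0 : (fun t => (0 : ℝ → EuclideanSpace ℝ (Fin 3) → EuclideanSpace ℝ (Fin 3)) (t + -s₁)) = 0 := rfl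
    rw [h0] at h
    exact h.mono (fun t ht => by
      simp only [mem_Ioo] at ht ⊢; constructor <;> linarith [ht.1, ht.2])
      isOpen_Ioo.uniqueDiffOn
  have heq : ∀ t ∈ Ioo s₁ T, u t = U' (t + -s₁) := by
    intro t ht
    have h1 : t + -s₁ ∈ Ico 0 (T - s₁) := ⟨by linarith [ht.1], by linarith [ht.2]⟩
    rw [hagree _ h1, hU]
    simp
  have hTb : T ≤ s₁ + T'' := by linarith
  exact ⟨s₁ + T'', by linarith, _, _, hcl.glue h₂ hs₁0 hs₁.2 hTb heq, fun t ht => by simp only [if_pos ht.2]⟩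

end Summit.NavierStokesRegularity.NavierStokesRegularity.Theorems.PlaneStrainDoorTypeFreeRungText

end
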